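import Summits.ResolutionOfSingularities.ResolutionOfSingularities.Theorems.WeightedInvariantELadderOneRungUnconditional
import Summits.ResolutionOfSingularities.ResolutionOfSingularities.Theorems.WeightedInvariantELadderTwoStage
import HarnessLib

/-!
# E-ladder rung `e = 2`, step piece (S-b1) — part 2: the induced atlas with its CHART MAP, COVER and UNIT TRANSFER

[OURS · L1 W4.3 · DOOR `HypersurfaceCentreConstruction` (stmt-ResolutionOfSingularities-19897) · E2 STEP piece (S-b1)
`E2InducedAtlasBody p` of the registrar's SPEC (Δ6b) `L/res-L1-w43-plan-1/E2Step_split_sketch.lean` (rev 3/4), ORDER/OFFER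
(o59-b1); written by res-D-pv-048 (gen 11); companion of `…ELadderTwoInducedAtlas` (part 1: the body verbatim).  Def-free
kernel lemmas; `--supports` the door item as a helper.  Replaces the role of: nothing printed — OURS bookkeeping of the
E-ladder, NOT a statement of the manuscript [Hironaka2017] or of any manuscript under adjudication; candidates not facts; AI
work, weaker than expert review.]

WHY A PART 2.  The (S-b2) hand (`E2AtlasReadingsBody`: readings of ANY induced atlas) has to DESCEND orbit-genericity from a
successor read point `η'` to `y = σ₊ η'` on EVERY unit chart `W a ∋ y` of the stage, so it needs, for every old chart `a`
through `y`, a successor chart OVER `a` through `η'` that is again a unit chart.  The registrar's `InducedAlong` records only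
«every successor chart lies over SOME old chart».  Part 1 re-ran the tree's construction
(`DatumToEmbedded.Atlas.gradedAtlas_succ_of_isRegularWeightedCentre`) recording the `AmbientChart` dictionary chart by chart;
here the same construction is recorded with

* the chart MAP `oc : 𝒜'.ι → 𝒜.ι` ("old chart") (the successor charts are `⟨a, b⟩ ↦ a`, `b` a generator of the downstairs centre
  `K(U a)`) and `hle : W' a' ≤ σ₊⁻¹ W (oc a')`;
* the uniform exponent `𝒜'.exponent = 𝒜.exponent * Dg`;
* COVER: for every point `x'` of the strict transform and every old chart `a ∋ σ₊ (i' x')` there is `a'` with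
  `oc a' = a` and `i' x' ∈ W' a'` (the blow-up charts `D₊(b)`, `b ∈ K(U a)`, cover `ρ⁻¹(U a)`);
* UNITS: homogeneous units of all degrees `e·ℤʲ` on `X ∩ W (oc a')` give homogeneous units of all degrees
  `(e Dg)·ℤʲ⁺¹` on `X' ∩ W' a'` (`exists_unit_chart`) — a unit chart below gives a unit chart above;
* the full `AmbientChart` dictionary of every chart (graded `σ₊♯`, `t⁻¹` of degree `(0,-1)`, `β`, the unit `η` of degree
  `(0, Dg)` with `η (t⁻¹)^{Dg} = σ₊♯ β`, the chart locus `mem_iff`, the degree-`0` sections `exists_of_mem_zero` /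
  `exists_mem_zero`, the strict-transform reading `σ₊♯ x ∈ I' ⇒ x β ∈ I`, and the quotient chart `U' a' = D₊(b)`).

Landed here: `DatumToEmbedded.Atlas.gradedAtlas_succ_cover_of_isRegularWeightedCentre` (generic, the re-run) and
`LocalEngine.e2InducedAtlas_cover` (for a stage over any field, from an ADMISSIBLE centre; Veronese degree, downstairs
centre `K ≠ ⊥` and lift packaged as in `DatumToEmbedded.quotientStep_of_isRegularWeightedCentre`).
-/

noncomputable section

open CategoryTheory CategoryTheory.Limits AlgebraicGeometry TopologicalSpace
open Literature.AlgebraicGeometry.Resolution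
open Summit.ResolutionOfSingularities.ResolutionOfSingularities.Theorems

set_option linter.dupNamespace false -- mandated namespace `…Theorems.DatumToEmbedded.<Topic>`
-- `Γ(B₊, W')` versus `presheaf.obj` inside `rw` motives and instance problems on the glued scheme
-- `R'.cobordantBlowup` / `R'.plus` (as in the source file `…WeightedThesisTowerGenericQuotient`):
set_option backward.isDefEq.respectTransparency false

/-! ## The graded atlas of rank `j + 1`: chart map, cover, units, dictionary -/

namespace Summit.ResolutionOfSingularities.ResolutionOfSingularities.Theorems.DatumToEmbedded.Atlas

/-- **The induced graded atlas of rank `j + 1` on the blow-up of the quotient, WITH ITS CHART MAP, COVER, UNIT TRANSFER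
AND DICTIONARY** (the text of `gradedAtlas_succ_of_isRegularWeightedCentre`, Włodarczyk §2.3.3 in the graded encoding,
re-run recording the construction): see the module docstring. [cite: Wlodarczyk2022, §2.3.3] -/
theorem gradedAtlas_succ_cover_of_isRegularWeightedCentre :
    ∀ {k : Type} [Field k]
      {Y X V : Scheme.{0}} (f : Y ⟶ Spec (.of k)) [Smooth f] [IsSeparated f] [QuasiCompact f]
      (i : X ⟶ Y) [IsClosedImmersion i] [IsIntegral X] (q : X ⟶ V) [IsIntegral V]
      (g : V ⟶ Spec (.of k)) [IsSeparated g] [LocallyOfFiniteType g] [QuasiCompact g],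
      q ≫ g = i ≫ f →
      ∀ {j : ℕ} (𝒜 : GradedAtlas j f i q) (R : ReesAlgebraData Y), R.IsRegularWeightedCentre →
      i (genericPoint X) ∉ R.support →
      (∀ (a : 𝒜.ι) (n : ℕ), @Ideal.IsHomogeneous (Fin j → ℤ) (AddSubgroup Γ(Y, 𝒜.W a))
        Γ(Y, 𝒜.W a) _ _ _ (𝒜.piece a) _ _ (𝒜.gradedRing a)
        ((R.piece n).ideal (𝒜.W a))) →
      ∀ (R' : ReesFiltration Y), R'.ideal = R.piece →
      ∀ [Smooth (R'.πPlus ≫ f)] [IsSeparated (R'.πPlus ≫ f)] [QuasiCompact (R'.πPlus ≫ f)]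
        [IsIntegral (R'.strictTransformPlus i.ker).subscheme]
        (σX : (R'.strictTransformPlus i.ker).subscheme ⟶ X),
        σX ≫ i = (R'.strictTransformPlus i.ker).subschemeι ≫ R'.πPlus →
      ∀ (Dg : ℕ), 0 < Dg →
      (R.piece Dg).comap R'.πPlus = R'.excPlus ^ Dg →
      (∀ (a : 𝒜.ι) (l : ℕ) (x : Γ(Y, 𝒜.W a)),
          x ∈ (R.piece (Dg * (l + 1))).ideal (𝒜.W a) → x ∈ 𝒜.piece a 0 →
          ∃ y ∈ AddSubgroup.closure
            {z : Γ(Y, 𝒜.W a) | ∃ u v : Γ(Y, 𝒜.W a),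
              u ∈ (R.piece Dg).ideal (𝒜.W a) ∧ u ∈ 𝒜.piece a 0 ∧
              v ∈ (R.piece (Dg * l)).ideal (𝒜.W a) ∧ v ∈ 𝒜.piece a 0 ∧
              z = u * v},
            x - y ∈ i.ker.ideal (𝒜.W a)) →
      ((((R.piece Dg).comap i).subschemeι ≫ q).ker).comap (σX ≫ q) =
          (R'.excPlus.comap (R'.strictTransformPlus i.ker).subschemeι) ^ Dg →
      ∀ (V' : Scheme.{0}) (ρ : V' ⟶ V),
        IsBlowup ρ (((R.piece Dg).comap i).subschemeι ≫ q).ker →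
        ∀ [IsIntegral V'] (q' : (R'.strictTransformPlus i.ker).subscheme ⟶ V'),
          q' ≫ ρ = σX ≫ q →
          ∃ (𝒜' : GradedAtlas (j + 1) (R'.πPlus ≫ f) (R'.strictTransformPlus i.ker).subschemeι q')
            (oc : 𝒜'.ι → 𝒜.ι)
            (hle : ∀ a' : 𝒜'.ι,
              (𝒜'.W a' : (R'.plus : Scheme.{0}).Opens) ≤ R'.πPlus ⁻¹ᵁ (𝒜.W (oc a') : Y.Opens)),
            -- uniform exponent of the successor atlas
            𝒜'.exponent = 𝒜.exponent * Dg ∧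
            -- COVER: over every old chart through `σ₊ (i' x')` there is a successor chart through `i' x'`
            (∀ (x' : ↥(R'.strictTransformPlus i.ker).subscheme) (a : 𝒜.ι),
              R'.πPlus.base ((R'.strictTransformPlus i.ker).subschemeι.base x') ∈ (𝒜.W a : Y.Opens) →
              ∃ a' : 𝒜'.ι, oc a' = a ∧
                (R'.strictTransformPlus i.ker).subschemeι.base x' ∈ (𝒜'.W a' : (R'.plus : Scheme.{0}).Opens)) ∧
            -- UNITS: a unit chart below gives a unit chart above (all degrees in `(e Dg)·ℤʲ⁺¹`)
            (∀ (a' : 𝒜'.ι) (e : ℕ),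
              (∀ χ : Fin j → ℤ, ∃ s ∈ 𝒜.piece (oc a') (e • χ), IsUnit (i.app (𝒜.W (oc a')) s)) →
              ∀ χ' : Fin (j + 1) → ℤ, ∃ s' ∈ 𝒜'.piece a' ((e * Dg) • χ'),
                IsUnit ((R'.strictTransformPlus i.ker).subschemeι.app (𝒜'.W a') s')) ∧
            -- DICTIONARY of the chart `a'` over `oc a'`
            ∀ a' : 𝒜'.ι,
              (∀ (χ : Fin j → ℤ) (s : Γ(Y, 𝒜.W (oc a'))), s ∈ 𝒜.piece (oc a') χ →
                R'.πPlus.appLE (𝒜.W (oc a')) (𝒜'.W a') (hle a') s ∈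
                  𝒜'.piece a' (Fin.snoc (α := fun _ => ℤ) χ 0)) ∧
              tInvOn R' (𝒜'.W a') ∈ 𝒜'.piece a' (Fin.snoc (α := fun _ => ℤ) 0 (-1)) ∧
              ∃ (β : Γ(Y, 𝒜.W (oc a'))) (η : Γ((R'.plus : Scheme.{0}), 𝒜'.W a')),
                β ∈ (R.piece Dg).ideal (𝒜.W (oc a')) ∧ β ∈ 𝒜.piece (oc a') 0 ∧ IsUnit η ∧
                η ∈ 𝒜'.piece a' (Fin.snoc (α := fun _ => ℤ) 0 (Dg : ℤ)) ∧
                η * tInvOn R' (𝒜'.W a') ^ Dg = R'.πPlus.appLE (𝒜.W (oc a')) (𝒜'.W a') (hle a') β ∧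
                -- the chart is the locus over `W (oc a')` where `σ₊♯ β = unit · (t⁻¹)^{Dg}`
                (∀ y' : (R'.plus : Scheme.{0}), y' ∈ (𝒜'.W a' : (R'.plus : Scheme.{0}).Opens) ↔
                  ∃ (O : (R'.plus : Scheme.{0}).affineOpens)
                    (hO : (O : (R'.plus : Scheme.{0}).Opens) ≤ R'.πPlus ⁻¹ᵁ (𝒜.W (oc a') : Y.Opens)),
                    y' ∈ (O : (R'.plus : Scheme.{0}).Opens) ∧ ∃ η₀ : Γ((R'.plus : Scheme.{0}), O),
                      IsUnit η₀ ∧ η₀ * tInvOn R' O ^ Dg = R'.πPlus.appLE (𝒜.W (oc a')) O hO β) ∧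
                -- every degree-`0` section is `x t^{Dg l} / η^l` with `x ∈ R_{Dg l}(W (oc a'))` of degree `0` …
                (∀ s ∈ 𝒜'.piece a' 0, ∃ (l : ℕ) (x : Γ(Y, 𝒜.W (oc a'))),
                  x ∈ (R.piece (Dg * l)).ideal (𝒜.W (oc a')) ∧ x ∈ 𝒜.piece (oc a') 0 ∧
                    s * η ^ l * tInvOn R' (𝒜'.W a') ^ (Dg * l) =
                      R'.πPlus.appLE (𝒜.W (oc a')) (𝒜'.W a') (hle a') x) ∧
                -- … and conversely
                (∀ (l : ℕ) (x : Γ(Y, 𝒜.W (oc a'))), x ∈ (R.piece (Dg * l)).ideal (𝒜.W (oc a')) →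
                  x ∈ 𝒜.piece (oc a') 0 → ∃ s ∈ 𝒜'.piece a' 0,
                    s * η ^ l * tInvOn R' (𝒜'.W a') ^ (Dg * l) =
                      R'.πPlus.appLE (𝒜.W (oc a')) (𝒜'.W a') (hle a') x) ∧
                -- strict-transform reading: `σ₊♯ x ∈ I'(W' a')  ⇒  x β ∈ I(W (oc a'))`
                (∀ x : Γ(Y, 𝒜.W (oc a')), R'.πPlus.appLE (𝒜.W (oc a')) (𝒜'.W a') (hle a') x ∈
                  (R'.strictTransformPlus i.ker).ideal (𝒜'.W a') → x * β ∈ i.ker.ideal (𝒜.W (oc a'))) ∧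
                -- the quotient chart is the blow-up chart of the generator `b` of `K(U (oc a'))` lifted by `β`
                ∃ b : Γ(V, 𝒜.U (oc a')),
                  b ∈ ((((R.piece Dg).comap i).subschemeι ≫ q).ker).ideal (𝒜.U (oc a')) ∧
                  i.app (𝒜.W (oc a')) β =
                    q.appLE (𝒜.U (oc a')) (i ⁻¹ᵁ (𝒜.W (oc a'))) (𝒜.preimage_eq (oc a')).le b ∧
                  (𝒜'.U a' : V'.Opens) =
                    blowupChart ρ ((((R.piece Dg).comap i).subschemeι ≫ q).ker) (𝒜.U (oc a')) b := by
  intro k _ Y X V f _ _ _ i _ _ q _ g _ _ _ hq j 𝒜 R hc hξ hhom R' hR' _ _ _ _ σX hσX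
    Dg hDg hexc hA2 hA3 V' ρ hρ _ q' hq'
  -- `Y` and `B` are locally Noetherian (the centre is a regular weighted centre)
  haveI : IsLocallyNoetherian Y := LocallyOfFiniteType.isLocallyNoetherian f
  haveI : LocallyOfFiniteType R'.π :=
    WeightedThesis.GlobalCobordantPlus.locallyOfFiniteType_π R R' hR' hc
  haveI : IsLocallyNoetherian R'.cobordantBlowup := LocallyOfFiniteType.isLocallyNoetherian R'.π
  -- `q` is quasi-compact (it is so after composition with the separated `g`)
  haveI : QuasiCompact q := by
    haveI : QuasiCompact (q ≫ g) := by rw [hq]; infer_instance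
    exact .of_comp q g
  -- `V` is locally Noetherian (of finite type over the field `k`)
  haveI : IsLocallyNoetherian V := LocallyOfFiniteType.isLocallyNoetherian g
  -- `t⁻¹` is not identically zero on the integral strict transform `X'`
  have hτ := Lift.nonempty_preimage_basicOpen_of_not_mem_support i R hc R' hR' hξ
  -- (0) finitely many generators of the downstairs centre `K(U a)` on every chart
  choose s hs using fun a : 𝒜.ι =>
    exists_finset_span_eq ((((R.piece Dg).comap i).subschemeι ≫ q).ker) (𝒜.U a)
  have hbK : ∀ ab : (Σ a : 𝒜.ι, ↥(s a)), (ab.2 : Γ(V, 𝒜.U ab.1)) ∈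
      ((((R.piece Dg).comap i).subschemeι ≫ q).ker).ideal (𝒜.U ab.1) :=
    fun ab => (hs ab.1).le (Ideal.subset_span (Finset.mem_coe.mpr ab.2.2))
  -- (1) degree-zero lifts `β` of the generators, the ambient charts, the quotient charts
  have hβex : ∀ ab : (Σ a : 𝒜.ι, ↥(s a)), ∃ β : Γ(Y, 𝒜.W ab.1),
      β ∈ (R.piece Dg).ideal (𝒜.W ab.1) ∧ β ∈ 𝒜.piece ab.1 0 ∧
        i.app (𝒜.W ab.1) β = q.appLE (𝒜.U ab.1) (i ⁻¹ᵁ (𝒜.W ab.1)) (𝒜.preimage_eq ab.1).le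
          (ab.2 : Γ(V, 𝒜.U ab.1)) :=
    fun ab => exists_degreeZero_lift 𝒜 R.piece Dg ab.1 (hhom ab.1 Dg) (hbK ab)
  choose β hβJ hβ0 hβ using hβex
  choose 𝒞 h𝒞 using fun ab : (Σ a : 𝒜.ι, ↥(s a)) =>
    AtlasAmbient.exists_ambientChart f i q 𝒜 R' hR' ab.1 (hhom ab.1) hDg (hβJ ab) (hβ0 ab)
  -- the quotient charts under the ambient charts (Q1)–(Q4)
  have hQ1 := fun ab : (Σ a : 𝒜.ι, ↥(s a)) =>
    AtlasQuotient.preimage_W'_eq f i q 𝒜 R.piece R' σX hσX Dg _ ρ q' hq' ab.1 hτ hA3 hρ hexc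
      (hbK ab) (hβJ ab) (hβ ab) (𝒞 ab)
  have hQ := fun ab : (Σ a : 𝒜.ι, ↥(s a)) =>
    And.intro (hQ1 ab) (And.intro (AtlasQuotient.appLE_blowupChart_mem_nonZeroDivisors hρ (hbK ab))
      (And.intro (fun c' => AtlasQuotient.exists_of_section_blowupChart hρ (hbK ab) c')
        (And.intro (fun (l : ℕ) (c : Γ(V, 𝒜.U ab.1))
            (hc' : c ∈ ((((R.piece Dg).comap i).subschemeι ≫ q).ker.ideal (𝒜.U ab.1)) ^ l) =>
            AtlasQuotient.exists_section_blowupChart hρ (hbK ab) hc')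
          (AtlasQuotient.app_blowupChart_injective f i q 𝒜 _ R' σX hσX Dg _ ρ hρ q' hq' ab.1
            (hbK ab) (hβ ab) (𝒞 ab) (h𝒞 ab) (hQ1 ab)))))
  -- COVER: over the old chart `a ∋ σ₊ (i' x')`, the chart `⟨a, b⟩` with `q' x' ∈ D₊(b)` contains `i' x'`
  have hcover : ∀ (x' : ↥(R'.strictTransformPlus i.ker).subscheme) (a : 𝒜.ι),
      R'.πPlus.base ((R'.strictTransformPlus i.ker).subschemeι.base x') ∈ (𝒜.W a : Y.Opens) →
      ∃ ab : (Σ a : 𝒜.ι, ↥(s a)), ab.1 = a ∧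
        (R'.strictTransformPlus i.ker).subschemeι.base x' ∈ ((𝒞 ab).W' : (R'.plus : Scheme.{0}).Opens) := by
    intro x' a hxa
    have hxa' : σX x' ∈ i ⁻¹ᵁ (𝒜.W a : Y.Opens) := by
      change i (σX x') ∈ (𝒜.W a : Y.Opens)
      have e1 : (σX ≫ i) x' = i (σX x') := Scheme.Hom.comp_apply _ _ _
      have e2 : ((R'.strictTransformPlus i.ker).subschemeι ≫ R'.πPlus) x' =
          R'.πPlus ((R'.strictTransformPlus i.ker).subschemeι x') := Scheme.Hom.comp_apply _ _ _
      rw [← e1, hσX, e2]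
      exact hxa
    have hqx : ρ (q' x') ∈ (𝒜.U a : V.Opens) := by
      have e1 : (q' ≫ ρ) x' = ρ (q' x') := Scheme.Hom.comp_apply _ _ _
      rw [← e1, hq', Scheme.Hom.comp_apply]
      change σX x' ∈ q ⁻¹ᵁ (𝒜.U a : V.Opens)
      rw [← 𝒜.preimage_eq a]
      exact hxa'
    obtain ⟨b, hb⟩ := exists_mem_blowupChart hρ (𝒜.U a) (s a) (hs a) hqx
    have h : x' ∈ q' ⁻¹ᵁ blowupChart ρ _ (𝒜.U a) (b : Γ(V, 𝒜.U a)) := hb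
    rw [← (hQ ⟨a, b⟩).1] at h
    exact ⟨⟨a, b⟩, rfl, h⟩
  -- (2)-(5) the atlas
  refine ⟨{
    ι := Σ a : 𝒜.ι, ↥(s a)
    finite_ι := by haveI := 𝒜.finite_ι; infer_instance
    U := fun ab => ⟨blowupChart ρ ((((R.piece Dg).comap i).subschemeι ≫ q).ker)
      (𝒜.U ab.1) (ab.2 : Γ(V, 𝒜.U ab.1)), hρ.isAffineOpen_blowupChart (hbK ab)⟩
    iSup_eq_top := stub_qs_atlasCover hρ 𝒜.U 𝒜.iSup_eq_top s hs
    W := fun ab => (𝒞 ab).W'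
    preimage_eq := fun ab => (hQ ab).1
    piece := fun ab => (𝒞 ab).piece
    gradedRing := fun ab => (𝒞 ab).gradedRing
    appLE_mem := fun ab c => (𝒞 ab).const_mem c
    isHomogeneous_ker := fun ab => isHomogeneous_ker_chart (𝒞 ab)
    exists_preimage := fun ab s' hs' =>
      exists_preimage_chart 𝒜 R.piece Dg hσX hτ hq' ab.1 (hβ ab) (𝒞 ab)
        (blowupChart_le_preimage ρ _ (𝒜.U ab.1) _) (hQ ab).1 (hA2 ab.1) (hQ ab).2.2.2.1 s' hs'
    exists_lift := fun ab c' =>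
      exists_lift_chart 𝒜 R.piece Dg hσX hτ hq' ab.1 (hβ ab) (𝒞 ab)
        (blowupChart_le_preimage ρ _ (𝒜.U ab.1) _) (hQ ab).1 R.piece_zero
        R.piece_mul_le (hhom ab.1 Dg) (hQ ab).2.2.1 c'
    appLE_injective := fun ab => appLE_injective_of_eq _ (hQ ab).1 (hQ ab).2.2.2.2
    exponent := 𝒜.exponent * Dg
    exponent_pos := Nat.mul_pos 𝒜.exponent_pos hDg
    exists_unit := ?_ }, fun ab => ab.1, fun ab => (𝒞 ab).le_preimage, ?_, ?_, ?_, ?_⟩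
  · -- homogeneous units of all degrees in `(e Dg)·ℤʲ⁺¹` near every point of `X'`
    intro x'
    obtain ⟨a, hxa, hunits⟩ := 𝒜.exists_unit (σX x')
    have hqx : ρ (q' x') ∈ (𝒜.U a : V.Opens) := by
      have e1 : (q' ≫ ρ) x' = ρ (q' x') := Scheme.Hom.comp_apply _ _ _
      rw [← e1, hq', Scheme.Hom.comp_apply]
      change σX x' ∈ q ⁻¹ᵁ (𝒜.U a : V.Opens)
      rw [← 𝒜.preimage_eq a]
      exact hxa
    obtain ⟨b, hb⟩ := exists_mem_blowupChart hρ (𝒜.U a) (s a) (hs a) hqx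
    refine ⟨⟨a, b⟩, ?_, fun χ' => exists_unit_chart hσX (𝒞 ⟨a, b⟩) 𝒜.exponent hunits χ'⟩
    have h : x' ∈ q' ⁻¹ᵁ blowupChart ρ _ (𝒜.U a) (b : Γ(V, 𝒜.U a)) := hb
    rw [← (hQ ⟨a, b⟩).1] at h
    exact h
  · -- the uniform exponent
    rfl
  · -- COVER
    exact hcover
  · -- UNITS: `exists_unit_chart` on the ambient chart `𝒞 a'`
    intro ab e hunits χ'
    exact exists_unit_chart hσX (𝒞 ab) e hunits χ'
  · -- the dictionary: the fields of the ambient charts `𝒞 ab`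
    intro ab
    exact ⟨(𝒞 ab).appLE_mem, (𝒞 ab).tInvOn_mem, β ab, (𝒞 ab).η,
      hβJ ab, hβ0 ab, (𝒞 ab).isUnit_η, (𝒞 ab).η_mem, (𝒞 ab).η_mul, (𝒞 ab).mem_iff,
      (𝒞 ab).exists_of_mem_zero, (𝒞 ab).exists_mem_zero, h𝒞 ab,
      (ab.2 : Γ(V, 𝒜.U ab.1)), hbK ab, hβ ab, rfl⟩


end Summit.ResolutionOfSingularities.ResolutionOfSingularities.Theorems.DatumToEmbedded.Atlas


/-! ## (S-b1) for a stage: chart map, cover, units, dictionary -/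

namespace Summit.ResolutionOfSingularities.ResolutionOfSingularities.Cruxes.HypersurfaceCentreConstruction.LocalEngine

open Summit.ResolutionOfSingularities.ResolutionOfSingularities.Theorems.ELadderOne

/-- **(S-b1) STRUCTURED SUCCESSOR ATLAS WITH CHART MAP, COVER, UNIT TRANSFER AND DICTIONARY, for a stage over any
field.**  Blowing up an admissible centre `R` of a stage `S` with the generic point of `X` off the support: for every Rees
filtration `R'` carrying the pieces of `R` there is a successor presentation `(V', ρ, q', 𝒜')` over `R'.plus` (`ρ` the
blow-up of the downstairs centre `K = ker (V(R_{Dg}) ∩ X ⟶ V)` for the uniform Veronese degree `Dg > 0`, `q'` the lift of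
`σ_X ≫ q`) whose rank-`j + 1` atlas is INDUCED along `σ₊` from the stage's: chart map `oc`, `W' a' ≤ σ₊⁻¹ W (oc a')`,
exponent `e Dg`, the COVER and UNIT-TRANSFER clauses the (S-b2) descent needs, and the `AmbientChart` dictionary of every
chart (`DatumToEmbedded.Atlas.gradedAtlas_succ_cover_of_isRegularWeightedCentre`). [cite: Wlodarczyk2022, §2.3.3 and Thm 1.1.4 (5)] -/
theorem e2InducedAtlas_cover {k : Type} [Field k] (S : Stage k)
    (R : ReesAlgebraData S.Y) (hadm : IsAdmissibleCentre S.f S.i.ker R) (hξ : S.i (genericPoint S.X) ∉ R.support)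
    (R' : ReesFiltration S.Y) (hR' : R'.ideal = R.piece)
    [Smooth (R'.πPlus ≫ S.f)] [IsSeparated (R'.πPlus ≫ S.f)] [QuasiCompact (R'.πPlus ≫ S.f)]
    [IsIntegral (R'.strictTransformPlus S.i.ker).subscheme] :
    ∃ (Dg : ℕ), 0 < Dg ∧
    ∃ (V' : Scheme.{0}) (ρ : V' ⟶ S.V) (_ : IsIntegral V') (_ : IsProper ρ)
      (_ : IsBlowup ρ ((((R.piece Dg).comap S.i).subschemeι ≫ S.q).ker))
      (q' : (R'.strictTransformPlus S.i.ker).subscheme ⟶ V')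
      (_ : q' ≫ ρ ≫ S.g = (R'.strictTransformPlus S.i.ker).subschemeι ≫ R'.πPlus ≫ S.f),
      ∃ (𝒜' : GradedAtlas (S.j + 1) (R'.πPlus ≫ S.f) (R'.strictTransformPlus S.i.ker).subschemeι q')
        (oc : 𝒜'.ι → S.atlas.ι)
        (hle : ∀ a' : 𝒜'.ι,
          (𝒜'.W a' : (R'.plus : Scheme.{0}).Opens) ≤ R'.πPlus ⁻¹ᵁ (S.atlas.W (oc a') : S.Y.Opens)),
        -- uniform exponent of the successor atlas
        𝒜'.exponent = S.atlas.exponent * Dg ∧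
        -- COVER: over every old chart through `σ₊ (i' x')` there is a successor chart through `i' x'`
        (∀ (x' : ↥(R'.strictTransformPlus S.i.ker).subscheme) (a : S.atlas.ι),
          R'.πPlus.base ((R'.strictTransformPlus S.i.ker).subschemeι.base x') ∈ (S.atlas.W a : S.Y.Opens) →
          ∃ a' : 𝒜'.ι, oc a' = a ∧
            (R'.strictTransformPlus S.i.ker).subschemeι.base x' ∈ (𝒜'.W a' : (R'.plus : Scheme.{0}).Opens)) ∧
        -- UNITS: a unit chart below gives a unit chart above (all degrees in `(e Dg)·ℤʲ⁺¹`)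
        (∀ (a' : 𝒜'.ι) (e : ℕ),
          (∀ χ : Fin S.j → ℤ, ∃ s ∈ S.atlas.piece (oc a') (e • χ), IsUnit (S.i.app (S.atlas.W (oc a')) s)) →
          ∀ χ' : Fin (S.j + 1) → ℤ, ∃ s' ∈ 𝒜'.piece a' ((e * Dg) • χ'),
            IsUnit ((R'.strictTransformPlus S.i.ker).subschemeι.app (𝒜'.W a') s')) ∧
        -- DICTIONARY of the chart `a'` over `oc a'`
        ∀ a' : 𝒜'.ι,
          (∀ (χ : Fin S.j → ℤ) (s : Γ(S.Y, S.atlas.W (oc a'))), s ∈ S.atlas.piece (oc a') χ →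
            R'.πPlus.appLE (S.atlas.W (oc a')) (𝒜'.W a') (hle a') s ∈
              𝒜'.piece a' (Fin.snoc (α := fun _ => ℤ) χ 0)) ∧
          tInvOn R' (𝒜'.W a') ∈ 𝒜'.piece a' (Fin.snoc (α := fun _ => ℤ) 0 (-1)) ∧
          ∃ (β : Γ(S.Y, S.atlas.W (oc a'))) (η : Γ((R'.plus : Scheme.{0}), 𝒜'.W a')),
            β ∈ (R.piece Dg).ideal (S.atlas.W (oc a')) ∧ β ∈ S.atlas.piece (oc a') 0 ∧ IsUnit η ∧
            η ∈ 𝒜'.piece a' (Fin.snoc (α := fun _ => ℤ) 0 (Dg : ℤ)) ∧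
            η * tInvOn R' (𝒜'.W a') ^ Dg = R'.πPlus.appLE (S.atlas.W (oc a')) (𝒜'.W a') (hle a') β ∧
            -- the chart is the locus over `W (oc a')` where `σ₊♯ β = unit · (t⁻¹)^{Dg}`
            (∀ y' : (R'.plus : Scheme.{0}), y' ∈ (𝒜'.W a' : (R'.plus : Scheme.{0}).Opens) ↔
              ∃ (O : (R'.plus : Scheme.{0}).affineOpens)
                (hO : (O : (R'.plus : Scheme.{0}).Opens) ≤ R'.πPlus ⁻¹ᵁ (S.atlas.W (oc a') : S.Y.Opens)),
                y' ∈ (O : (R'.plus : Scheme.{0}).Opens) ∧ ∃ η₀ : Γ((R'.plus : Scheme.{0}), O),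
                  IsUnit η₀ ∧ η₀ * tInvOn R' O ^ Dg = R'.πPlus.appLE (S.atlas.W (oc a')) O hO β) ∧
            -- every degree-`0` section is `x t^{Dg l} / η^l` with `x ∈ R_{Dg l}(W (oc a'))` of degree `0` …
            (∀ s ∈ 𝒜'.piece a' 0, ∃ (l : ℕ) (x : Γ(S.Y, S.atlas.W (oc a'))),
              x ∈ (R.piece (Dg * l)).ideal (S.atlas.W (oc a')) ∧ x ∈ S.atlas.piece (oc a') 0 ∧
                s * η ^ l * tInvOn R' (𝒜'.W a') ^ (Dg * l) =
                  R'.πPlus.appLE (S.atlas.W (oc a')) (𝒜'.W a') (hle a') x) ∧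
            -- … and conversely
            (∀ (l : ℕ) (x : Γ(S.Y, S.atlas.W (oc a'))), x ∈ (R.piece (Dg * l)).ideal (S.atlas.W (oc a')) →
              x ∈ S.atlas.piece (oc a') 0 → ∃ s ∈ 𝒜'.piece a' 0,
                s * η ^ l * tInvOn R' (𝒜'.W a') ^ (Dg * l) =
                  R'.πPlus.appLE (S.atlas.W (oc a')) (𝒜'.W a') (hle a') x) ∧
            -- strict-transform reading: `σ₊♯ x ∈ I'(W' a')  ⇒  x β ∈ I(W (oc a'))`
            (∀ x : Γ(S.Y, S.atlas.W (oc a')), R'.πPlus.appLE (S.atlas.W (oc a')) (𝒜'.W a') (hle a') x ∈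
              (R'.strictTransformPlus S.i.ker).ideal (𝒜'.W a') → x * β ∈ S.i.ker.ideal (S.atlas.W (oc a'))) ∧
            -- the quotient chart is the blow-up chart of the generator `b` of `K(U (oc a'))` lifted by `β`
            ∃ b : Γ(S.V, S.atlas.U (oc a')),
              b ∈ ((((R.piece Dg).comap S.i).subschemeι ≫ S.q).ker).ideal (S.atlas.U (oc a')) ∧
              S.i.app (S.atlas.W (oc a')) β =
                S.q.appLE (S.atlas.U (oc a')) (S.i ⁻¹ᵁ (S.atlas.W (oc a'))) (S.atlas.preimage_eq (oc a')).le b ∧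
              (𝒜'.U a' : V'.Opens) =
                blowupChart ρ ((((R.piece Dg).comap S.i).subschemeι ≫ S.q).ker) (S.atlas.U (oc a')) b := by
  have hc : R.IsRegularWeightedCentre := hadm.1
  haveI : IsLocallyNoetherian S.Y := LocallyOfFiniteType.isLocallyNoetherian S.f
  haveI : IsLocallyNoetherian S.V := LocallyOfFiniteType.isLocallyNoetherian S.g
  -- the strict transform maps to `X` (the total transform lies in the strict transform)
  set I' := R'.strictTransformPlus S.i.ker with hI'
  let i' := I'.subschemeι
  have hker : S.i.ker ≤ (i' ≫ R'.πPlus).ker :=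
    DatumToEmbedded.StrictTransform.le_ker_subschemeι_comp_πPlus R' S.i.ker
  let σX : I'.subscheme ⟶ S.X := IsClosedImmersion.lift S.i (i' ≫ R'.πPlus) hker
  have hσX : σX ≫ S.i = i' ≫ R'.πPlus := IsClosedImmersion.lift_fac _ _ _
  -- (hom) of the admissible centre on the charts of the presentation
  have hH := hadm.2.2
  have hhom : ∀ (a : S.atlas.ι) (n : ℕ), @Ideal.IsHomogeneous (Fin S.j → ℤ)
      (AddSubgroup Γ(S.Y, S.atlas.W a)) Γ(S.Y, S.atlas.W a) _ _ _ (S.atlas.piece a) _ _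
      (S.atlas.gradedRing a) ((R.piece n).ideal (S.atlas.W a)) := fun a n =>
    @hH S.j (S.atlas.W a) (S.atlas.piece a) (S.atlas.gradedRing a) (S.atlas.appLE_mem a)
      (S.atlas.isHomogeneous_ker a) n
  -- the Veronese degree, the downstairs centre `K ≠ ⊥` and the lift (as in `quotientStep_of_isRegularWeightedCentre`)
  haveI : CompactSpace S.Y := QuasiCompact.compactSpace_of_compactSpace S.f
  obtain ⟨N₀, hN₀, hexc⟩ :=
    DatumToEmbedded.Exceptional.exists_veroneseExceptional_of_isRegularWeightedCentre R hc R' hR'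
  obtain ⟨Dg, hDg, hdvd, hA2, hA3⟩ := DatumToEmbedded.Degree.qs_degree_of_isRegularWeightedCentre S.f S.i S.q S.g
    S.hq S.atlas R hc hhom R' hR' σX hσX N₀ hN₀ hexc
  haveI : QuasiCompact S.q := by
    haveI : QuasiCompact (S.q ≫ S.g) := by rw [S.hq]; infer_instance
    exact .of_comp S.q S.g
  obtain ⟨hK, hlift⟩ := DatumToEmbedded.Lift.qs_lift_of_not_mem_support S.i S.q R hc R' hR' hξ σX hσX Dg hDg hA3
  -- the blow-up of the downstairs centre and the induced atlas with its chart map / cover / units / dictionary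
  obtain ⟨V', ρ, hρ⟩ := exists_isBlowup S.V ((((R.piece Dg).comap S.i).subschemeι ≫ S.q).ker)
  haveI : IsProper ρ := hρ.isProper
  haveI : IsIntegral V' := hρ.isIntegral hK
  obtain ⟨q', hq'⟩ := hlift V' ρ hρ
  obtain ⟨𝒜', oc, hle, hexp, hcov, hunit, hdict⟩ :=
    DatumToEmbedded.Atlas.gradedAtlas_succ_cover_of_isRegularWeightedCentre S.f S.i S.q S.g S.hq S.atlas R hc hξ hhom
      R' hR' σX hσX Dg hDg (hexc Dg hdvd) hA2 hA3 V' ρ hρ q' hq'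
  have hq'' : q' ≫ ρ ≫ S.g = i' ≫ R'.πPlus ≫ S.f := by
    rw [← Category.assoc, hq', Category.assoc, S.hq, ← Category.assoc, hσX, Category.assoc]
  exact ⟨Dg, hDg, V', ρ, inferInstance, inferInstance, hρ, q', hq'', 𝒜', oc, hle, hexp, hcov, hunit, hdict⟩

end Summit.ResolutionOfSingularities.ResolutionOfSingularities.Cruxes.HypersurfaceCentreConstruction.LocalEngine

end
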